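import Literature.NumberTheory.DiophantineGeometry.FirstRowPeeling
import HarnessLib

/-!
# Polynomial permify, file A — the power-saving first-row hook inequality (⋆G₄)

Infrastructure for O-L1-29 «POLYNOMIAL PERMIFY» (workshop lens-1, g37). Pure arithmetic, no
representation theory. For a partition `μ = (a, ν) ⊢ n` with first row `a = μ₁`, body `ν ⊢ j = n - a`
and body column lengths `u_s = ν'_s` (an antitone sequence with `u_0 + 1 = μ'_0 ≤ a` when the first row
is at least as long as the first column, and `∑_{s<a} u_s ≤ j`), the first-row hook lengths are
`(a - s) + u_s` (`Literature.NumberTheory.DiophantineGeometry.Nat.Partition.numStandardTableaux_mul_prod_firstRow`).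
The main theorem of this file,

* `firstRow_hook_pow_four_le` — **`(∏_{s<a} ((a-s)+u_s))^4 ≤ (∏_{s<a} (a-s)) · (∏_{s<a} ((a-s)+j))^3`**,

i.e. `Π^4 ≤ a! · (n!/j!)^3`, is the per-step inequality behind the co-volume law
`n! ≤ (f^λ)^4 · |R′| · |C′|` for commuting row/column piece pairs (file B). Proof: the middle boxes
`1 ≤ s ≤ a-2` are compared termwise through the real inequality `(m+u)^4 ≤ m (m+Ju)^3`
(`0 ≤ u ≤ Jm`, `J ≥ 2`; here `m = a-s`, `J = s+1`, using `(s+1)·u_s ≤ ∑_{t≤s} u_t ≤ j`), and the two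
end boxes `s = 0`, `s = a-1` are compared jointly (`a·u_{a-1} ≤ j`, `u_0 ≤ min (j, a-1)`).

HONEST BOUNDARY: 0 S-currency; closes NO item; infrastructure for O-L1-29 (RULING bus 3382);
arithmetic only — no dial claim is made in this file; stmt-23702 / VP ≠ VNP untouched.
-/

set_option linter.dupNamespace false

namespace Summit.ValiantsHypothesis.ValiantsHypothesis.Theorems.EquivariantDialPolyPermify

/-- Real core of the middle-box comparison: `(m+u)^4 ≤ m·(m+J·u)^3` for `m > 0`, `0 ≤ u ≤ J·m`,
`J ≥ 2` (small `u ≤ 4m`: compare with `(m+2u)^3`; large `u`: `m·(Ju)^3 ≥ u^6/m^2 ≥ 16u^4`). -/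
theorem add_pow_four_le_mul_cube (m u J : ℝ) (hm : 0 < m) (hu : 0 ≤ u) (hJ : 2 ≤ J)
    (huJ : u ≤ J * m) : (m + u) ^ 4 ≤ m * (m + J * u) ^ 3 := by
  have hJ0 : 0 ≤ J := by linarith
  have hJu : m + 2 * u ≤ m + J * u := by nlinarith
  have hstep : m * (m + 2 * u) ^ 3 ≤ m * (m + J * u) ^ 3 :=
    mul_le_mul_of_nonneg_left (pow_le_pow_left₀ (by positivity) hJu 3) hm.le
  rcases le_or_gt u (4 * m) with h4 | h4
  · have key : m * (m + 2 * u) ^ 3 - (m + u) ^ 4 =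
        2 * m ^ 3 * u + 6 * m ^ 2 * u ^ 2 + u ^ 3 * (4 * m - u) := by ring
    have h4' : 0 ≤ 4 * m - u := by linarith
    have hnn : 0 ≤ 2 * m ^ 3 * u + 6 * m ^ 2 * u ^ 2 + u ^ 3 * (4 * m - u) :=
      add_nonneg (add_nonneg (by positivity) (by positivity)) (mul_nonneg (by positivity) h4')
    linarith
  · have h2 : (m + u) ^ 4 ≤ 16 * u ^ 4 := by
      have hle : m + u ≤ 2 * u := by linarith
      calc (m + u) ^ 4 ≤ (2 * u) ^ 4 := pow_le_pow_left₀ (by positivity) hle 4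
        _ = 16 * u ^ 4 := by ring
    have h3 : u ^ 2 ≤ m * (J * u) := by nlinarith
    have h5 : 16 * m ^ 2 ≤ u ^ 2 := by nlinarith
    have hJu3 : (J * u) ^ 3 ≤ (m + J * u) ^ 3 :=
      pow_le_pow_left₀ (by positivity) (by linarith) 3
    have h6 : m ^ 2 * (m + u) ^ 4 ≤ m ^ 2 * (m * (m + J * u) ^ 3) :=
      calc m ^ 2 * (m + u) ^ 4 ≤ m ^ 2 * (16 * u ^ 4) := by gcongr
        _ = (16 * m ^ 2) * u ^ 4 := by ring
        _ ≤ u ^ 2 * u ^ 4 := by gcongr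
        _ = (u ^ 2) ^ 3 := by ring
        _ ≤ (m * (J * u)) ^ 3 := pow_le_pow_left₀ (by positivity) h3 3
        _ = m ^ 2 * (m * (J * u) ^ 3) := by ring
        _ ≤ m ^ 2 * (m * (m + J * u) ^ 3) := by gcongr
    exact le_of_mul_le_mul_left h6 (by positivity)

/-- The middle-box comparison in `ℕ`: `(m+v)^4 ≤ m·(m+j)^3` whenever `1 ≤ m`, `2 ≤ J`, `v ≤ J·m`
and `J·v ≤ j`. -/
theorem middle_term_le (m v J j : ℕ) (hm : 1 ≤ m) (hJ : 2 ≤ J) (hvJ : v ≤ J * m)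
    (hj : J * v ≤ j) : (m + v) ^ 4 ≤ m * (m + j) ^ 3 := by
  have h1 : ((m : ℝ) + v) ^ 4 ≤ m * (m + J * v) ^ 3 :=
    add_pow_four_le_mul_cube m v J (by exact_mod_cast hm) (by positivity) (by exact_mod_cast hJ)
      (by exact_mod_cast hvJ)
  have h2 : (m : ℝ) * (m + J * v) ^ 3 ≤ m * (m + j) ^ 3 := by
    have : (J : ℝ) * v ≤ j := by exact_mod_cast hj
    gcongr
  exact_mod_cast h1.trans h2

/-- The end-pair core: `(a+u₀)^4·(a+j) ≤ a^5·(1+j)^3` for `a ≥ 2`, `u₀ ≤ j`, `u₀ + 1 ≤ a`. -/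
theorem endpair_core (a j u₀ : ℕ) (ha : 2 ≤ a) (hu₀j : u₀ ≤ j) (hu₀a : u₀ + 1 ≤ a) :
    (a + u₀) ^ 4 * (a + j) ≤ a ^ 5 * (1 + j) ^ 3 := by
  rcases Nat.lt_or_ge j 3 with hj | hj
  · obtain rfl | rfl | rfl : j = 0 ∨ j = 1 ∨ j = 2 := by omega
    · -- j = 0
      have hu : u₀ = 0 := by omega
      subst hu
      simp [pow_succ]
    · -- j = 1 : (a+1)^5 ≤ 8 a^5
      have hle : (a + u₀) ^ 4 * (a + 1) ≤ (a + 1) ^ 5 := by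
        have : a + u₀ ≤ a + 1 := by omega
        calc (a + u₀) ^ 4 * (a + 1) ≤ (a + 1) ^ 4 * (a + 1) :=
              Nat.mul_le_mul_right _ (Nat.pow_le_pow_left this 4)
          _ = (a + 1) ^ 5 := by ring
      have h32 : 32 * (a + 1) ^ 5 ≤ 32 * (a ^ 5 * (1 + 1) ^ 3) := by
        have h : 2 * (a + 1) ≤ 3 * a := by omega
        have h' := Nat.pow_le_pow_left h 5
        calc 32 * (a + 1) ^ 5 = (2 * (a + 1)) ^ 5 := by ring
          _ ≤ (3 * a) ^ 5 := h'
          _ = 243 * a ^ 5 := by ring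
          _ ≤ 256 * a ^ 5 := by omega
          _ = 32 * (a ^ 5 * (1 + 1) ^ 3) := by ring
      exact hle.trans (Nat.le_of_mul_le_mul_left h32 (by norm_num))
    · -- j = 2
      rcases Nat.lt_or_ge a 3 with ha3 | ha3
      · have ha2 : a = 2 := by omega
        subst ha2
        have hu : u₀ ≤ 1 := by omega
        have : (2 + u₀) ^ 4 * (2 + 2) ≤ (2 + 1) ^ 4 * (2 + 2) :=
          Nat.mul_le_mul_right _ (Nat.pow_le_pow_left (by omega) 4)
        exact this.trans (by norm_num)
      · have hle : (a + u₀) ^ 4 * (a + 2) ≤ (a + 2) ^ 5 := by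
          have : a + u₀ ≤ a + 2 := by omega
          calc (a + u₀) ^ 4 * (a + 2) ≤ (a + 2) ^ 4 * (a + 2) :=
                Nat.mul_le_mul_right _ (Nat.pow_le_pow_left this 4)
            _ = (a + 2) ^ 5 := by ring
        have h243 : 243 * (a + 2) ^ 5 ≤ 243 * (a ^ 5 * (1 + 2) ^ 3) := by
          have h : 3 * (a + 2) ≤ 5 * a := by omega
          have h' := Nat.pow_le_pow_left h 5
          calc 243 * (a + 2) ^ 5 = (3 * (a + 2)) ^ 5 := by ring
            _ ≤ (5 * a) ^ 5 := h'
            _ = 3125 * a ^ 5 := by ring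
            _ ≤ 6561 * a ^ 5 := by omega
            _ = 243 * (a ^ 5 * (1 + 2) ^ 3) := by ring
        exact hle.trans (Nat.le_of_mul_le_mul_left h243 (by norm_num))
  · -- j ≥ 3 : (a+u₀)^4 ≤ 16 a^4 and 16 (a+j) ≤ a (1+j)^3
    have h1 : (a + u₀) ^ 4 ≤ 16 * a ^ 4 := by
      have : a + u₀ ≤ 2 * a := by omega
      calc (a + u₀) ^ 4 ≤ (2 * a) ^ 4 := Nat.pow_le_pow_left this 4
        _ = 16 * a ^ 4 := by ring
    have h2 : 16 * (a + j) ≤ a * (1 + j) ^ 3 := by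
      have hsq : 16 ≤ (1 + j) ^ 2 := by
        calc 16 = 4 ^ 2 := by norm_num
          _ ≤ (1 + j) ^ 2 := Nat.pow_le_pow_left (by omega) 2
      have h3 : a * (1 + j) ^ 3 = (a * (1 + j)) * (1 + j) ^ 2 := by ring
      rw [h3]
      calc 16 * (a + j) ≤ (a * (1 + j)) * 16 := by nlinarith
        _ ≤ (a * (1 + j)) * (1 + j) ^ 2 := Nat.mul_le_mul_left _ hsq
    calc (a + u₀) ^ 4 * (a + j) ≤ 16 * a ^ 4 * (a + j) := Nat.mul_le_mul_right _ h1
      _ = a ^ 4 * (16 * (a + j)) := by ring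
      _ ≤ a ^ 4 * (a * (1 + j) ^ 3) := Nat.mul_le_mul_left _ h2
      _ = a ^ 5 * (1 + j) ^ 3 := by ring

/-- The end pair: boxes `s = 0` (hook `a + u₀`) and `s = a-1` (hook `1 + u_{a-1}`) together,
under `a·u_{a-1} ≤ j` (antitone sum bound), `u₀ ≤ j`, `u₀ + 1 ≤ a`, `a ≥ 2`. -/
theorem endpair_le (a j u₀ ul : ℕ) (ha : 2 ≤ a) (hu₀j : u₀ ≤ j) (hu₀a : u₀ + 1 ≤ a)
    (hul : a * ul ≤ j) :
    (a + u₀) ^ 4 * (1 + ul) ^ 4 ≤ (a * (a + j) ^ 3) * (1 * (1 + j) ^ 3) := by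
  have hcore := endpair_core a j u₀ ha hu₀j hu₀a
  have h1 : a * (1 + ul) ≤ a + j := by nlinarith
  have h2 : a ^ 4 * ((a + u₀) ^ 4 * (1 + ul) ^ 4) ≤ a ^ 4 * ((a * (a + j) ^ 3) * (1 * (1 + j) ^ 3)) :=
    calc a ^ 4 * ((a + u₀) ^ 4 * (1 + ul) ^ 4) = (a + u₀) ^ 4 * (a * (1 + ul)) ^ 4 := by ring
      _ ≤ (a + u₀) ^ 4 * (a + j) ^ 4 := Nat.mul_le_mul_left _ (Nat.pow_le_pow_left h1 4)
      _ = ((a + u₀) ^ 4 * (a + j)) * (a + j) ^ 3 := by ring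
      _ ≤ (a ^ 5 * (1 + j) ^ 3) * (a + j) ^ 3 := Nat.mul_le_mul_right _ hcore
      _ = a ^ 4 * ((a * (a + j) ^ 3) * (1 * (1 + j) ^ 3)) := by ring
  exact Nat.le_of_mul_le_mul_left h2 (by positivity)

/-- Partial sums of an antitone sequence: `(s+1)·u_s ≤ ∑_{t<a} u_t` for `s < a`. -/
theorem succ_mul_le_sum_of_antitone (u : ℕ → ℕ) (hanti : Antitone u) (a s : ℕ) (hs : s < a) :
    (s + 1) * u s ≤ ∑ t ∈ Finset.range a, u t := by
  calc (s + 1) * u s = ∑ t ∈ Finset.range (s + 1), u s := by simp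
    _ ≤ ∑ t ∈ Finset.range (s + 1), u t :=
        Finset.sum_le_sum fun t ht => hanti (Nat.lt_succ_iff.mp (Finset.mem_range.mp ht))
    _ ≤ ∑ t ∈ Finset.range a, u t :=
        Finset.sum_le_sum_of_subset_of_nonneg (Finset.range_mono (by omega)) (fun _ _ _ => Nat.zero_le _)

/-- Splitting a product over `range (k+2)` into the middle boxes `1, …, k` and the two end boxes
`0` and `k+1`. -/
theorem prod_range_succ_succ_split (f : ℕ → ℕ) (k : ℕ) :
    ∏ s ∈ Finset.range (k + 1 + 1), f s = (∏ s ∈ Finset.range k, f (s + 1)) * (f 0 * f (k + 1)) := by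
  rw [Finset.prod_range_succ, Finset.prod_range_succ']
  ring

/-- **(⋆G₄) — the power-saving first-row hook inequality.** For an antitone `u : ℕ → ℕ` with
`u 0 + 1 ≤ a` and `∑_{s<a} u s ≤ j`,
`(∏_{s<a} ((a-s) + u s))^4 ≤ (∏_{s<a} (a-s)) · (∏_{s<a} ((a-s) + j))^3`
(that is, `Π^4 ≤ a! · ((a+j)!/j!)^3` for the first-row hook product `Π` of a partition `(a, ν)`,
`u = ν'`, `j = |ν|`). -/
theorem firstRow_hook_pow_four_le (a j : ℕ) (u : ℕ → ℕ) (hanti : Antitone u) (hu0 : u 0 + 1 ≤ a)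
    (hsum : ∑ s ∈ Finset.range a, u s ≤ j) :
    (∏ s ∈ Finset.range a, ((a - s) + u s)) ^ 4 ≤
      (∏ s ∈ Finset.range a, (a - s)) * (∏ s ∈ Finset.range a, ((a - s) + j)) ^ 3 := by
  rw [← Finset.prod_pow, ← Finset.prod_pow, ← Finset.prod_mul_distrib]
  obtain ⟨k, rfl⟩ : ∃ k, a = k + 1 := ⟨a - 1, by omega⟩
  rcases Nat.eq_zero_or_pos k with hk | hk
  · subst hk
    have hu : u 0 = 0 := by omega
    simp [hu]
    exact Nat.one_le_pow _ _ (by omega)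
  obtain ⟨k, rfl⟩ : ∃ k', k = k' + 1 := ⟨k - 1, by omega⟩
  -- `a = k + 2`: split off the middle boxes and the two end boxes `s = 0`, `s = k + 1`.
  rw [prod_range_succ_succ_split, prod_range_succ_succ_split]
  have hu0j : u 0 ≤ j := by
    have h := succ_mul_le_sum_of_antitone u hanti (k + 1 + 1) 0 (by omega)
    simp at h
    omega
  have hul : (k + 1 + 1) * u (k + 1) ≤ j := by
    have h := succ_mul_le_sum_of_antitone u hanti (k + 1 + 1) (k + 1) (by omega)
    exact (le_of_eq (by ring)).trans (h.trans hsum)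
  -- middle boxes, termwise
  have hmid : ∏ x ∈ Finset.range k, (k + 1 + 1 - (x + 1) + u (x + 1)) ^ 4 ≤
      ∏ x ∈ Finset.range k, ((k + 1 + 1 - (x + 1)) * (k + 1 + 1 - (x + 1) + j) ^ 3) := by
    refine Finset.prod_le_prod (fun _ _ => Nat.zero_le _) fun x hx => ?_
    have hxk : x < k := Finset.mem_range.mp hx
    have hm : k + 1 + 1 - (x + 1) = k + 1 - x := by omega
    rw [hm]
    refine middle_term_le (k + 1 - x) (u (x + 1)) (x + 2) j (by omega) (by omega) ?_ ?_
    · -- u (x+1) ≤ u 0 ≤ a - 1 = k + 1 ≤ (x+2) * (k+1-x)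
      have h1 : u (x + 1) ≤ u 0 := hanti (Nat.zero_le _)
      have h2 : k + 1 ≤ (x + 2) * (k + 1 - x) := by
        obtain ⟨d, hd⟩ : ∃ d, k = x + d := ⟨k - x, by omega⟩
        subst hd
        have : x + d + 1 - x = d + 1 := by omega
        rw [this]
        nlinarith
      omega
    · have h := succ_mul_le_sum_of_antitone u hanti (k + 1 + 1) (x + 1) (by omega)
      exact (le_of_eq (by ring)).trans (h.trans hsum)
  -- the two end boxes, jointly
  have hend : (k + 1 + 1 - 0 + u 0) ^ 4 * (k + 1 + 1 - (k + 1) + u (k + 1)) ^ 4 ≤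
      ((k + 1 + 1 - 0) * (k + 1 + 1 - 0 + j) ^ 3) *
        ((k + 1 + 1 - (k + 1)) * (k + 1 + 1 - (k + 1) + j) ^ 3) := by
    have e1 : k + 1 + 1 - 0 = k + 1 + 1 := rfl
    have e2 : k + 1 + 1 - (k + 1) = 1 := by omega
    rw [e1, e2]
    exact endpair_le (k + 1 + 1) j (u 0) (u (k + 1)) (by omega) hu0j hu0 hul
  exact Nat.mul_le_mul hmid hend

end Summit.ValiantsHypothesis.ValiantsHypothesis.Theorems.EquivariantDialPolyPermify
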